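import Summits.ResolutionOfSingularities.ResolutionOfSingularities.Theorems.HomologicalConductorNoZenoExcCurveCount
import Summits.ResolutionOfSingularities.ResolutionOfSingularities.Theorems.HomologicalConductorNoZenoThreadTower
import Literature.AlgebraicGeometry.Resolution.ExceptionalFibreConnected
import Literature.AlgebraicGeometry.Resolution.RationalSurfaceSingularitiesBasic
import Literature.AlgebraicGeometry.Resolution.ExceptionalPointsFinite
import Literature.AlgebraicGeometry.Resolution.ExceptionalCurvePoints
import HarnessLib

/-!
# Crux `NoZenoR` / `NoZeno` (stmt-ResolutionOfSingularities-19943 / -16483), β layer: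
# (L0) + (∃N) — exceptional count zero ⇔ regular; rational germs have finite count; thread germs

Route `ResolutionOfSingularities/HomologicalConductor`.  OURS (cell res-hironaka, chain W4.4); nothing here is a
statement of the manuscript under review.  Over U7's vocabulary `ExcCount.HasExcCurveCountLE`
(`…NoZenoExcCurveCount`, res-D-pv-039): for a two-dimensional normal Noetherian local domain, exceptional count `0`
forces regularity (purity of the exceptional fibre of a resolution of a SINGULAR normal surface germ: tree
`IsResolution.excCurvePoints_nonempty`, Lipman 1969 §10), so together with U7's
`hasExcCurveCountLE_zero_of_isRegularLocalRing` the count-zero germs are exactly the regular ones; and along a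
singular prime thread in tr.deg 3 no germ has count `0` (T-GERM: all thread germs are singular); and (∃N) a RATIONAL
two-dimensional normal germ has SOME finite exceptional count (Lipman (4.1): the minimal resolution exists;
`excPoints_finite`).  These are inputs (L0) and β2b `stub_threadCount` of the β2(n=3) rational-habitat descent
(CHAIN W4.4 v15 §3 / (ρ15b)), (L0) discharged outright and (∃N) modulo the named fact `Lipman1969_4_1`.

References: J. Lipman, Publ. Math. IHÉS 36 (1969), §10 [`Lipman1969`].
-/

noncomputable section

-- single-problem summit: the doubled namespace component `ResolutionOfSingularities` is forced
set_option linter.dupNamespace false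

namespace Summit.ResolutionOfSingularities.ResolutionOfSingularities.Theorems.NoZeno.SandwichCluster.Thread

open IsLocalRing AlgebraicGeometry
open Summit.ResolutionOfSingularities.ResolutionOfSingularities.Theses.HomologicalConductor
open Summit.ResolutionOfSingularities.ResolutionOfSingularities.Theorems.NoZeno.Birth
open Summit.ResolutionOfSingularities.ResolutionOfSingularities.Theorems.NoZeno.ExcCount (HasExcCurveCountLE
  hasExcCurveCountLE_zero_of_isRegularLocalRing)
open Literature.AlgebraicGeometry.Resolution

variable {k K : Type} [Field k] [Field K] [Algebra k K]

/-- **(L0): exceptional count zero ⇒ regular.**  For a two-dimensional normal Noetherian local domain `R`,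
`HasExcCurveCountLE R 0` forces `R` regular: a resolution of a SINGULAR such `R` has a non-empty set of integral
exceptional curves (`IsResolution.excCurvePoints_nonempty`). [cite: Lipman1969, Section 10 (p. 212)] -/
theorem isRegularLocalRing_of_hasExcCurveCountLE_zero {R : Type} [CommRing R] [IsNoetherianRing R] [IsDomain R]
    [IsLocalRing R] [IsIntegrallyClosed R] (h2 : ringKrullDim R = 2) (h : HasExcCurveCountLE R 0) :
    IsRegularLocalRing R := by
  obtain ⟨X, π, hπ, hfin, hcard⟩ := h
  by_contra hsing
  have hne := hπ.isResolution.excCurvePoints_nonempty h2 hsing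
  have h0 : (excCurvePoints π).ncard = 0 := Nat.le_zero.mp hcard
  rw [Set.ncard_eq_zero hfin] at h0
  exact hne.ne_empty h0

/-- **Count zero ⇔ regular** for two-dimensional normal Noetherian local domains (with U7's
`hasExcCurveCountLE_zero_of_isRegularLocalRing`). [this work] -/
theorem hasExcCurveCountLE_zero_iff {R : Type} [CommRing R] [IsNoetherianRing R] [IsDomain R]
    [IsLocalRing R] [IsIntegrallyClosed R] (h2 : ringKrullDim R = 2) :
    HasExcCurveCountLE R 0 ↔ IsRegularLocalRing R :=
  ⟨isRegularLocalRing_of_hasExcCurveCountLE_zero h2, fun h => by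
    haveI := h; exact hasExcCurveCountLE_zero_of_isRegularLocalRing R⟩

/-- **Along a thread no germ has exceptional count zero**: at a normalised stage `T_(n+1)` of a tr.deg-3 singular
prime thread, the germ `D = (T_(n+1))_P` is a two-dimensional normal SINGULAR local domain (T-GERM), hence
`¬ HasExcCurveCountLE D 0`. [this work] -/
theorem not_hasExcCurveCountLE_zero_of_thread (O : ValuationSubring K) (A : Subalgebra k K)
    (hk : ∀ c : k, algebraMap k K c ∈ O) (hA : A.FG) (hfr : IsFractionRing ↥A K)
    (hAO : A.toSubring ≤ O.toSubring) (htr : Algebra.trdeg k K = 3) (n : ℕ)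
    (P : Ideal ↥(tower O A (n + 1))) (hP : P.IsPrime)
    (hca : ∀ (x : K) (hx : x ∈ tower O A (n + 1)), x ∈ ca (tower O A (n + 1)) →
      (⟨x, hx⟩ : ↥(tower O A (n + 1))) ∈ P)
    (hs : ∃ (s : K) (hs : s ∈ tower O A (n + 1)), O.valuation s < 1 ∧
      (⟨s, hs⟩ : ↥(tower O A (n + 1))) ∉ P) :
    ¬ @HasExcCurveCountLE ↥(Parasite.locPrime (tower O A (n + 1)) P hP) _
      (Parasite.isLocalRing_locPrime _ _ _) 0 := by
  intro h0
  haveI := hP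
  haveI := hfr
  obtain ⟨hdim, hIC, hsing, -⟩ := threadGerm_of_trdeg O A hk hA hfr hAO htr n P hP hca hs
  haveI : IsNoetherianRing ↥(tower O A (n + 1)) := stub_towerNoetherian k K O A hk hA hfr hAO (n + 1)
  letI : Algebra ↥(tower O A (n + 1)) ↥(Parasite.locPrime (tower O A (n + 1)) P hP) :=
    (Subring.inclusion (toSubring_le_locPrime (tower O A (n + 1)) P hP)).toAlgebra
  haveI := isLocalization_locPrime (tower O A (n + 1)) P hP
  haveI : IsNoetherianRing ↥(Parasite.locPrime (tower O A (n + 1)) P hP) :=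
    IsLocalization.isNoetherianRing P.primeCompl _ inferInstance
  haveI : IsLocalRing ↥(Parasite.locPrime (tower O A (n + 1)) P hP) := Parasite.isLocalRing_locPrime _ _ _
  haveI := hIC
  exact hsing (isRegularLocalRing_of_hasExcCurveCountLE_zero hdim h0)

/-! ## (∃N): rational germs have a finite exceptional count (mod Lipman (4.1)) -/

/-- **(∃N)** A two-dimensional normal Noetherian local domain with a RATIONAL singularity has some finite exceptional
count `N(R) ≤ N`: the minimal resolution exists (Lipman (4.1), `Lipman1969_4_1.exists_isMinimalResolution_Spec`) and
its integral exceptional curves are finitely many (`excPoints_finite`, `excCurvePoints_subset_excPoints`).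
[cite: Lipman1969, Theorem (4.1) (p. 204)] -/
theorem exists_hasExcCurveCountLE_of_hasRationalSingularity (h41 : Lipman1969_4_1.{0}) {R : Type} [CommRing R]
    [IsNoetherianRing R] [IsLocalRing R] [IsDomain R] [IsIntegrallyClosed R] (hdim : ringKrullDim R = 2)
    (hrat : HasRationalSingularity R) : ∃ N : ℕ, HasExcCurveCountLE R N := by
  obtain ⟨X, f, hf⟩ := h41.exists_isMinimalResolution_Spec R hdim hrat
  haveI : IsProper f := hf.isResolution.isProper
  have hfin : (excCurvePoints f).Finite :=
    (excPoints_finite f).subset (hf.isResolution.excCurvePoints_subset_excPoints hdim)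
  exact ⟨(excCurvePoints f).ncard, X, f, hf, hfin, le_rfl⟩

/-- **β2b by name for the thread germs** (mod `Lipman1969_4_1`): a RATIONAL germ `D = (T_(n+1))_P` of a tr.deg-3
singular prime thread has some finite exceptional count. [this work] -/
theorem exists_hasExcCurveCountLE_threadGerm (h41 : Lipman1969_4_1.{0}) (O : ValuationSubring K)
    (A : Subalgebra k K) (hk : ∀ c : k, algebraMap k K c ∈ O) (hA : A.FG) (hfr : IsFractionRing ↥A K)
    (hAO : A.toSubring ≤ O.toSubring) (htr : Algebra.trdeg k K = 3) (n : ℕ)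
    (P : Ideal ↥(tower O A (n + 1))) (hP : P.IsPrime)
    (hca : ∀ (x : K) (hx : x ∈ tower O A (n + 1)), x ∈ ca (tower O A (n + 1)) →
      (⟨x, hx⟩ : ↥(tower O A (n + 1))) ∈ P)
    (hs : ∃ (s : K) (hs : s ∈ tower O A (n + 1)), O.valuation s < 1 ∧
      (⟨s, hs⟩ : ↥(tower O A (n + 1))) ∉ P)
    (hrat : HasRationalSingularity ↥(Parasite.locPrime (tower O A (n + 1)) P hP)) :
    ∃ N : ℕ, @HasExcCurveCountLE ↥(Parasite.locPrime (tower O A (n + 1)) P hP) _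
      (Parasite.isLocalRing_locPrime _ _ _) N := by
  haveI := hP
  haveI := hfr
  obtain ⟨hdim, hIC, -⟩ := threadGerm_of_trdeg O A hk hA hfr hAO htr n P hP hca hs
  haveI : IsNoetherianRing ↥(tower O A (n + 1)) := stub_towerNoetherian k K O A hk hA hfr hAO (n + 1)
  letI : Algebra ↥(tower O A (n + 1)) ↥(Parasite.locPrime (tower O A (n + 1)) P hP) :=
    (Subring.inclusion (toSubring_le_locPrime (tower O A (n + 1)) P hP)).toAlgebra
  haveI := isLocalization_locPrime (tower O A (n + 1)) P hP
  haveI : IsNoetherianRing ↥(Parasite.locPrime (tower O A (n + 1)) P hP) :=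
    IsLocalization.isNoetherianRing P.primeCompl _ inferInstance
  haveI : IsLocalRing ↥(Parasite.locPrime (tower O A (n + 1)) P hP) := Parasite.isLocalRing_locPrime _ _ _
  haveI := hIC
  exact exists_hasExcCurveCountLE_of_hasRationalSingularity h41 hdim hrat

end Summit.ResolutionOfSingularities.ResolutionOfSingularities.Theorems.NoZeno.SandwichCluster.Thread

end
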